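import Literature.Probability.Percolation.ConditionalPositiveAssociationProofs
import HarnessLib

/-!
# The law-level two-point exclusion is a theorem: `2·Cov(f,g) ≥ P(x↔q)·E[fg; x↔p] + P(x↔p)·E[fg; x↔q] − E[f; x↔p]E[g; x↔q] − E[f; x↔q]E[g; x↔p]`

Support file (`--supports stmt-CriticalPhenomena-4575`, closed), prover `prim-lf-2` (gen 47).  No definitions, no named facts, no sorries; standard axioms.
Memo `prim-lf-2/CW-QMIX-gen47.md` §1; the one-point case `p = q` is gen 46's `noCore_lawLevel` (…CoefficientwiseNoCoreLaw.lean).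

prim-lf-2's coefficientwise CONJECTURE Q_mix (CW-BOX-gen46 §2(d),(f); CW-QMIX-gen47): for the uniform two-colouring `s` of the edges of every multigraph, root `x`,
vertices `p, q`, monotone `f, g`, `Σ_{s : ¬(p ∈ C_x(s) ∧ q ∈ C_x(sᶜ))} (f(C_x s) − f(C_x sᶜ))(g(C_x s) − g(C_x sᶜ)) ≥ 0` (`p = q = y` is CONJECTURE NO-CORE; 0 negatives on
all graphs with ≤ 7 vertices).  Averaged over minors it becomes a statement about two INDEPENDENT copies `ω₁, ω₂` of bond percolation with arbitrary edge weights,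
`E[(1 − 1[p ∈ C¹]·1[q ∈ C²])·(f(C¹) − f(C²))(g(C¹) − g(C²))] ≥ 0`, i.e. in ONE copy, with `P = {x ↔ p}`, `Q = {x ↔ q}`,
  `2·(E[fg] − E f·E g) ≥ P(Q)·E[fg 1_P] + P(P)·E[fg 1_Q] − E[f 1_P]·E[g 1_Q] − E[f 1_Q]·E[g 1_P]`.
Unlike the coefficientwise form this IS a theorem, by the FIVE-TERM IDENTITY (memo §1)
  `Q_mix^law(p,q) = P(Q)·OFF^law(p) + P(P)·OFF^law(q) + 2·P(Pᶜ)P(Qᶜ)·Cov(f,g) + Cov(1_P,f)·Cov(1_Q,g) + Cov(1_Q,f)·Cov(1_P,g)`,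
where `OFF^law(v) := E[1[v ∉ C¹](f(C¹) − f(C²))(g(C¹) − g(C²))] = 2E[fg] − E[fg 1_V] − P(V)E[fg] − 2 E f E g + E[f 1_V] E g + E[g 1_V] E f ≥ 0` is the law-level
OFF-CLUSTER inequality (here from van den Berg–Häggström–Kahn's Theorem 1.2 on `{x ↮ v}` and Harris: `P(Vᶜ)·OFF^law(v) ≥ Cov(1_V,f)·Cov(1_V,g) ≥ 0`), and the
three covariance terms are products of Harris-nonnegative covariances.

* `Coefficientwise.offCluster_lawLevel` — `OFF^law(v) ≥ 0` in BHK2006's finite-sum form;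
* `Coefficientwise.qmix_lawLevel` — the display (law-level Q_mix ≥ 0), for every finite vertex type, all edge weights in `[0,1]`, `F, G ≥ 0` increasing functions of
  `openEdgeCluster ω x`.
[cite: VandenbergHaggstromKahn2005, Thm. 1.2 (p. 5), Thm. 1.3 (p. 6) (the ingredient); KozmaNitzan2024, Questions 8–9 (§5.5 p. 36) (context)]
-/

namespace Summit.CriticalPhenomena.PercolationContinuityZ3.Theorems

open Finset Literature.Probability.Percolation Literature.Probability.Percolation.BHK2006
open DecisionTree (ind ind_of_mem ind_of_not_mem ind_nonneg)

namespace Coefficientwise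

open Classical in
/-- **van den Berg–Häggström–Kahn's Theorem 1.2 at one point, in covariance form.**  With `a = E f`, `aV = E[f 1_{x↔v}]`, etc. (weights `w`, `∑ weight = 1`,
`F, G ≥ 0` increasing functions of `C_x`): `(a − aV)(b − bV) ≤ (c − cV)(1 − πV)`, i.e. `E[f;x↮v]E[g;x↮v] ≤ E[fg;x↮v]·P(x↮v)`.
(Extracted from gen 46's `noCore_lawLevel`; `BHK2006.core` with `X = Y = {v}`.) [cite: VandenbergHaggstromKahn2005, Thm. 1.2 (p. 5)] -/
theorem bhk12_point {V : Type*} [Fintype V] (w : Sym2 V → ℝ) (hw0 : ∀ e, 0 ≤ w e) (hw1 : ∀ e, w e ≤ 1)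
    (hm : ∑ ω, weight w ω = 1) (x v : V) (F G : Set (Sym2 V) → ℝ) (hF : Monotone F) (hG : Monotone G)
    (hF0 : ∀ a, 0 ≤ F a) (hG0 : ∀ a, 0 ≤ G a) :
    ((∑ ω, weight w ω * F (openEdgeCluster ω x)) -
        ∑ ω, weight w ω * (F (openEdgeCluster ω x) * ind {ω : Set (Sym2 V) | (openGraph ω).Reachable x v} ω)) *
      ((∑ ω, weight w ω * G (openEdgeCluster ω x)) -
        ∑ ω, weight w ω * (G (openEdgeCluster ω x) * ind {ω : Set (Sym2 V) | (openGraph ω).Reachable x v} ω)) ≤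
    ((∑ ω, weight w ω * (F (openEdgeCluster ω x) * G (openEdgeCluster ω x))) -
        ∑ ω, weight w ω * (F (openEdgeCluster ω x) * G (openEdgeCluster ω x) *
          ind {ω : Set (Sym2 V) | (openGraph ω).Reachable x v} ω)) *
      (1 - ∑ ω, weight w ω * ind {ω : Set (Sym2 V) | (openGraph ω).Reachable x v} ω) := by
  set Y : Set (Set (Sym2 V)) := {ω | (openGraph ω).Reachable x v} with hY
  set f : Set (Sym2 V) → ℝ := fun ω => F (openEdgeCluster ω x) with hf
  set g : Set (Sym2 V) → ℝ := fun ω => G (openEdgeCluster ω x) with hg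
  set a := ∑ ω, weight w ω * f ω with ha
  set b := ∑ ω, weight w ω * g ω with hb
  set c := ∑ ω, weight w ω * (f ω * g ω) with hc
  set p := ∑ ω, weight w ω * ind Y ω with hp
  set aY := ∑ ω, weight w ω * (f ω * ind Y ω) with haY
  set bY := ∑ ω, weight w ω * (g ω * ind Y ω) with hbY
  set cY := ∑ ω, weight w ω * (f ω * g ω * ind Y ω) with hcY
  change (a - aY) * (b - bY) ≤ (c - cY) * (1 - p)
  by_cases hxv : x = v
  · have hall : ∀ ω : Set (Sym2 V), ω ∈ Y := fun ω => by
      rw [hY, Set.mem_setOf_eq, hxv]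
    have e1 : aY = a := Finset.sum_congr rfl fun ω _ => by rw [ind_of_mem (hall ω), mul_one]
    have e2 : bY = b := Finset.sum_congr rfl fun ω _ => by rw [ind_of_mem (hall ω), mul_one]
    have e3 : cY = c := Finset.sum_congr rfl fun ω _ => by rw [ind_of_mem (hall ω), mul_one]
    rw [e1, e2, e3]; simp
  · have hE : ∀ ω : Set (Sym2 V), ω ∩ edgesIn (Finset.univ : Finset V) = ω := fun ω => by
      ext e
      simp only [Set.mem_inter_iff, edgesIn, Set.mem_setOf_eq, Finset.mem_univ, imp_true_iff, and_true]
    have hC : ∀ ω, rC Finset.univ x ω = openEdgeCluster ω x := fun ω => by simp only [rC, hE]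
    have hD : ∀ ω, ind (rD Finset.univ x ({v} : Set V)) ω = 1 - ind Y ω := by
      intro ω
      have hmem : ω ∈ rD Finset.univ x ({v} : Set V) ↔ ω ∉ Y := by
        simp only [rD, hE, hY, Set.mem_setOf_eq, Set.mem_singleton_iff, forall_eq]
      by_cases hω : ω ∈ Y
      · rw [ind_of_mem hω, ind_of_not_mem (fun h => (hmem.mp h) hω)]; norm_num
      · rw [ind_of_not_mem hω, ind_of_mem (hmem.mpr hω)]; norm_num
    have hvU : ({v} : Set V) ⊆ ↑(Finset.univ : Finset V) := by simp
    have key := core w hw0 hw1 hm Finset.univ x (Finset.mem_univ x) {v} {v} hvU hvU F G hF hG hF0 hG0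
    rw [Set.inter_self, Set.union_self] at key
    simp only [hC, hD] at key
    have s1 : ∑ ω, weight w ω * (F (openEdgeCluster ω x) * (1 - ind Y ω)) = a - aY := by
      rw [ha, haY, ← Finset.sum_sub_distrib]
      exact Finset.sum_congr rfl fun ω _ => by simp only [hf]; ring
    have s2 : ∑ ω, weight w ω * (G (openEdgeCluster ω x) * (1 - ind Y ω)) = b - bY := by
      rw [hb, hbY, ← Finset.sum_sub_distrib]
      exact Finset.sum_congr rfl fun ω _ => by simp only [hg]; ring
    have s3 : ∑ ω, weight w ω * (F (openEdgeCluster ω x) * G (openEdgeCluster ω x) * (1 - ind Y ω)) = c - cY := by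
      rw [hc, hcY, ← Finset.sum_sub_distrib]
      exact Finset.sum_congr rfl fun ω _ => by simp only [hf, hg]; ring
    have s4 : ∑ ω, weight w ω * (1 - ind Y ω) = 1 - p := by
      rw [hp]
      have : ∑ ω, weight w ω * (1 - ind Y ω) = ∑ ω, weight w ω - ∑ ω, weight w ω * ind Y ω := by
        rw [← Finset.sum_sub_distrib]; exact Finset.sum_congr rfl fun ω _ => by ring
      rw [this, hm]
    rw [s1, s2, s3, s4] at key
    exact key

open Classical in
/-- **Law-level OFF-CLUSTER inequality.**  With the notation of `bhk12_point` (`a = E f`, `πV = P(x↔v)`, `aV = E[f 1_{x↔v}]`, …),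
`OFF^law(v) := (c − cV) + (1 − πV)·c − (a − aV)·b − (b − bV)·a ≥ 0` — this is `E[1[v ∉ C¹](f(C¹) − f(C²))(g(C¹) − g(C²))] ≥ 0` for two independent copies;
indeed `(1 − πV)·OFF^law(v) ≥ (aV − πV·a)(bV − πV·b) = Cov(1_V,f)·Cov(1_V,g) ≥ 0` by `bhk12_point` and Harris.  (The two-colouring version
`Σ_{v ∉ C_x(s)} Δf Δg ≥ 0` is gen 23's THEOREM `offCluster_twoColouring_nonneg`.) [cite: VandenbergHaggstromKahn2005, Thm. 1.2 (p. 5)] -/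
theorem offCluster_lawLevel {V : Type*} [Fintype V] (w : Sym2 V → ℝ) (hw0 : ∀ e, 0 ≤ w e) (hw1 : ∀ e, w e ≤ 1)
    (hm : ∑ ω, weight w ω = 1) (x v : V) (F G : Set (Sym2 V) → ℝ) (hF : Monotone F) (hG : Monotone G)
    (hF0 : ∀ a, 0 ≤ F a) (hG0 : ∀ a, 0 ≤ G a) :
    0 ≤ ((∑ ω, weight w ω * (F (openEdgeCluster ω x) * G (openEdgeCluster ω x))) -
          ∑ ω, weight w ω * (F (openEdgeCluster ω x) * G (openEdgeCluster ω x) *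
            ind {ω : Set (Sym2 V) | (openGraph ω).Reachable x v} ω)) +
        (1 - ∑ ω, weight w ω * ind {ω : Set (Sym2 V) | (openGraph ω).Reachable x v} ω) *
          (∑ ω, weight w ω * (F (openEdgeCluster ω x) * G (openEdgeCluster ω x))) -
        ((∑ ω, weight w ω * F (openEdgeCluster ω x)) -
          ∑ ω, weight w ω * (F (openEdgeCluster ω x) * ind {ω : Set (Sym2 V) | (openGraph ω).Reachable x v} ω)) *
          (∑ ω, weight w ω * G (openEdgeCluster ω x)) -
        ((∑ ω, weight w ω * G (openEdgeCluster ω x)) -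
          ∑ ω, weight w ω * (G (openEdgeCluster ω x) * ind {ω : Set (Sym2 V) | (openGraph ω).Reachable x v} ω)) *
          (∑ ω, weight w ω * F (openEdgeCluster ω x)) := by
  have h3 := bhk12_point w hw0 hw1 hm x v F G hF hG hF0 hG0
  set Y : Set (Set (Sym2 V)) := {ω | (openGraph ω).Reachable x v} with hY
  set f : Set (Sym2 V) → ℝ := fun ω => F (openEdgeCluster ω x) with hf
  set g : Set (Sym2 V) → ℝ := fun ω => G (openEdgeCluster ω x) with hg
  set a := ∑ ω, weight w ω * f ω with ha
  set b := ∑ ω, weight w ω * g ω with hb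
  set c := ∑ ω, weight w ω * (f ω * g ω) with hc
  set p := ∑ ω, weight w ω * ind Y ω with hp
  set aY := ∑ ω, weight w ω * (f ω * ind Y ω) with haY
  set bY := ∑ ω, weight w ω * (g ω * ind Y ω) with hbY
  set cY := ∑ ω, weight w ω * (f ω * g ω * ind Y ω) with hcY
  change (a - aY) * (b - bY) ≤ (c - cY) * (1 - p) at h3
  change 0 ≤ (c - cY) + (1 - p) * c - (a - aY) * b - (b - bY) * a
  have hfm : Monotone f := fun a b hab => hF (openEdgeCluster_mono hab x)
  have hgm : Monotone g := fun a b hab => hG (openEdgeCluster_mono hab x)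
  have hf0 : ∀ a, 0 ≤ f a := fun a => hF0 _
  have hg0 : ∀ a, 0 ≤ g a := fun a => hG0 _
  have hYup : ∀ {a b : Set (Sym2 V)}, a ⊆ b → a ∈ Y → b ∈ Y := fun hab ha => by
    simp only [hY, Set.mem_setOf_eq] at ha ⊢
    exact ha.mono (openGraph_le hab)
  have hIm : Monotone (ind Y) := by
    intro a b hab
    by_cases ha : a ∈ Y
    · rw [ind_of_mem ha, ind_of_mem (hYup hab ha)]
    · rw [ind_of_not_mem ha]; exact ind_nonneg Y b
  have hI0 : ∀ a, 0 ≤ ind Y a := fun a => ind_nonneg Y a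
  have hI1 : ∀ a, ind Y a ≤ 1 := fun a => ind_le_one Y a
  have h1 : a * b ≤ c := by
    have := harris hw0 hw1 hf0 hg0 hfm hgm
    rw [hm, one_mul] at this
    exact this
  have h2a : a * p ≤ aY := by
    have := harris hw0 hw1 hf0 hI0 hfm hIm
    rw [hm, one_mul] at this
    exact this
  have h2b : b * p ≤ bY := by
    have := harris hw0 hw1 hg0 hI0 hgm hIm
    rw [hm, one_mul] at this
    exact this
  have hp0 : 0 ≤ p := Finset.sum_nonneg fun ω _ => mul_nonneg (weight_nonneg hw0 hw1 ω) (hI0 ω)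
  have hp1 : p ≤ 1 := by
    have : p ≤ ∑ ω, weight w ω :=
      Finset.sum_le_sum fun ω _ => by
        have := mul_le_mul_of_nonneg_left (hI1 ω) (weight_nonneg hw0 hw1 ω)
        simpa using this
    rw [hm] at this; exact this
  have ha0 : 0 ≤ a := Finset.sum_nonneg fun ω _ => mul_nonneg (weight_nonneg hw0 hw1 ω) (hf0 ω)
  have hb0 : 0 ≤ b := Finset.sum_nonneg fun ω _ => mul_nonneg (weight_nonneg hw0 hw1 ω) (hg0 ω)
  have haY1 : aY ≤ a := Finset.sum_le_sum fun ω _ => by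
    have : f ω * ind Y ω ≤ f ω := by nlinarith [hf0 ω, hI1 ω, hI0 ω]
    exact mul_le_mul_of_nonneg_left this (weight_nonneg hw0 hw1 ω)
  have hbY1 : bY ≤ b := Finset.sum_le_sum fun ω _ => by
    have : g ω * ind Y ω ≤ g ω := by nlinarith [hg0 ω, hI1 ω, hI0 ω]
    exact mul_le_mul_of_nonneg_left this (weight_nonneg hw0 hw1 ω)
  have hcY1 : cY ≤ c := Finset.sum_le_sum fun ω _ => by
    have : f ω * g ω * ind Y ω ≤ f ω * g ω := by nlinarith [mul_nonneg (hf0 ω) (hg0 ω), hI1 ω, hI0 ω]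
    exact mul_le_mul_of_nonneg_left this (weight_nonneg hw0 hw1 ω)
  -- certificate: (1-p)·OFF = [(c-cY)(1-p) - (a-aY)(b-bY)] + (1-p)²(c - ab) + (aY - p a)(bY - p b)
  have hT : (1 - p) * ((c - cY) + (1 - p) * c - (a - aY) * b - (b - bY) * a) =
      ((c - cY) * (1 - p) - (a - aY) * (b - bY)) + (1 - p) ^ 2 * (c - a * b) + (aY - p * a) * (bY - p * b) := by
    ring
  have hR : 0 ≤ ((c - cY) * (1 - p) - (a - aY) * (b - bY)) + (1 - p) ^ 2 * (c - a * b) + (aY - p * a) * (bY - p * b) := by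
    have t1 : 0 ≤ (c - cY) * (1 - p) - (a - aY) * (b - bY) := by linarith
    have t2 : 0 ≤ (1 - p) ^ 2 * (c - a * b) := mul_nonneg (sq_nonneg _) (by linarith)
    have t3 : 0 ≤ (aY - p * a) * (bY - p * b) := mul_nonneg (by linarith) (by linarith)
    linarith
  by_cases hpeq : p = 1
  · -- full mass on `Y`: aY = a, bY = b, cY = c and OFF = 0
    have e1 : aY = a := le_antisymm haY1 (by nlinarith)
    have e2 : bY = b := le_antisymm hbY1 (by nlinarith)
    have e3 : cY = c := by
      have hq : ∑ ω, weight w ω * (1 - ind Y ω) = 0 := by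
        have : ∑ ω, weight w ω * (1 - ind Y ω) = ∑ ω, weight w ω - ∑ ω, weight w ω * ind Y ω := by
          rw [← Finset.sum_sub_distrib]; exact Finset.sum_congr rfl fun ω _ => by ring
        rw [this, hm, ← hp, hpeq, sub_self]
      have hzero : ∀ ω, weight w ω * (1 - ind Y ω) = 0 := by
        have hnn : ∀ ω ∈ (Finset.univ : Finset (Set (Sym2 V))), 0 ≤ weight w ω * (1 - ind Y ω) :=
          fun ω _ => mul_nonneg (weight_nonneg hw0 hw1 ω) (by linarith [hI1 ω])
        intro ω
        exact (Finset.sum_eq_zero_iff_of_nonneg hnn).mp hq ω (Finset.mem_univ ω)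
      have : c - cY = 0 := by
        rw [hc, hcY, ← Finset.sum_sub_distrib]
        refine Finset.sum_eq_zero fun ω _ => ?_
        have : weight w ω * (f ω * g ω) - weight w ω * (f ω * g ω * ind Y ω) = (weight w ω * (1 - ind Y ω)) * (f ω * g ω) := by ring
        rw [this, hzero ω, zero_mul]
      linarith
    rw [e1, e2, e3, hpeq]; ring_nf; exact le_refl _
  · have hlt : p < 1 := lt_of_le_of_ne hp1 hpeq
    have hpos : 0 < 1 - p := by linarith
    have : 0 ≤ (1 - p) * ((c - cY) + (1 - p) * c - (a - aY) * b - (b - bY) * a) := by rw [hT]; exact hR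
    nlinarith [this, hpos]

open Classical in
/-- **Law-level Q_mix** (prim-lf-2 gen 47; the two-colouring version is CONJECTURE Q_mix of memo CW-QMIX-gen47, `p = q` is gen 46's `noCore_lawLevel`).
For bond percolation with edge weights `w ∈ [0,1]` on a finite vertex type (`∑ weight w = 1`), a root `x`, vertices `p, q`, `P = {ω | x ↔ p}`, `Q = {ω | x ↔ q}`,
and `F, G ≥ 0` increasing, `f = F ∘ C_x`, `g = G ∘ C_x`:
  `P(Q)·E[fg 1_P] + P(P)·E[fg 1_Q] − E[f 1_P]·E[g 1_Q] − E[f 1_Q]·E[g 1_P] ≤ 2·(E[fg] − E f·E g)`,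
i.e. `E[(1 − 1[x↔p in ω₁]·1[x↔q in ω₂])(f(ω₁) − f(ω₂))(g(ω₁) − g(ω₂))] ≥ 0` for two independent copies.  Proof: the five-term identity
`2Cov − (…) = P(Q)·OFF^law(p) + P(P)·OFF^law(q) + 2P(Pᶜ)P(Qᶜ)·Cov(f,g) + Cov(1_P,f)Cov(1_Q,g) + Cov(1_Q,f)Cov(1_P,g)` (`ring`), `offCluster_lawLevel` twice and
Harris five times. [cite: VandenbergHaggstromKahn2005, Thm. 1.2 (p. 5), Thm. 1.3 (p. 6)] -/
theorem qmix_lawLevel {V : Type*} [Fintype V] (w : Sym2 V → ℝ) (hw0 : ∀ e, 0 ≤ w e) (hw1 : ∀ e, w e ≤ 1)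
    (hm : ∑ ω, weight w ω = 1) (x p q : V) (F G : Set (Sym2 V) → ℝ) (hF : Monotone F) (hG : Monotone G)
    (hF0 : ∀ a, 0 ≤ F a) (hG0 : ∀ a, 0 ≤ G a) :
    (∑ ω, weight w ω * ind {ω : Set (Sym2 V) | (openGraph ω).Reachable x q} ω) *
        (∑ ω, weight w ω * (F (openEdgeCluster ω x) * G (openEdgeCluster ω x) *
          ind {ω : Set (Sym2 V) | (openGraph ω).Reachable x p} ω)) +
      (∑ ω, weight w ω * ind {ω : Set (Sym2 V) | (openGraph ω).Reachable x p} ω) *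
        (∑ ω, weight w ω * (F (openEdgeCluster ω x) * G (openEdgeCluster ω x) *
          ind {ω : Set (Sym2 V) | (openGraph ω).Reachable x q} ω)) -
      (∑ ω, weight w ω * (F (openEdgeCluster ω x) * ind {ω : Set (Sym2 V) | (openGraph ω).Reachable x p} ω)) *
        (∑ ω, weight w ω * (G (openEdgeCluster ω x) * ind {ω : Set (Sym2 V) | (openGraph ω).Reachable x q} ω)) -
      (∑ ω, weight w ω * (F (openEdgeCluster ω x) * ind {ω : Set (Sym2 V) | (openGraph ω).Reachable x q} ω)) *
        (∑ ω, weight w ω * (G (openEdgeCluster ω x) * ind {ω : Set (Sym2 V) | (openGraph ω).Reachable x p} ω)) ≤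
    2 * ((∑ ω, weight w ω * (F (openEdgeCluster ω x) * G (openEdgeCluster ω x))) -
      (∑ ω, weight w ω * F (openEdgeCluster ω x)) * (∑ ω, weight w ω * G (openEdgeCluster ω x))) := by
  have hOp := offCluster_lawLevel w hw0 hw1 hm x p F G hF hG hF0 hG0
  have hOq := offCluster_lawLevel w hw0 hw1 hm x q F G hF hG hF0 hG0
  set P : Set (Set (Sym2 V)) := {ω | (openGraph ω).Reachable x p} with hP
  set Q : Set (Set (Sym2 V)) := {ω | (openGraph ω).Reachable x q} with hQ
  set f : Set (Sym2 V) → ℝ := fun ω => F (openEdgeCluster ω x) with hf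
  set g : Set (Sym2 V) → ℝ := fun ω => G (openEdgeCluster ω x) with hg
  set a := ∑ ω, weight w ω * f ω with ha
  set b := ∑ ω, weight w ω * g ω with hb
  set c := ∑ ω, weight w ω * (f ω * g ω) with hc
  set πp := ∑ ω, weight w ω * ind P ω with hπp
  set aP := ∑ ω, weight w ω * (f ω * ind P ω) with haP
  set bP := ∑ ω, weight w ω * (g ω * ind P ω) with hbP
  set cP := ∑ ω, weight w ω * (f ω * g ω * ind P ω) with hcP
  set πq := ∑ ω, weight w ω * ind Q ω with hπq
  set aQ := ∑ ω, weight w ω * (f ω * ind Q ω) with haQ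
  set bQ := ∑ ω, weight w ω * (g ω * ind Q ω) with hbQ
  set cQ := ∑ ω, weight w ω * (f ω * g ω * ind Q ω) with hcQ
  change 0 ≤ (c - cP) + (1 - πp) * c - (a - aP) * b - (b - bP) * a at hOp
  change 0 ≤ (c - cQ) + (1 - πq) * c - (a - aQ) * b - (b - bQ) * a at hOq
  change πq * cP + πp * cQ - aP * bQ - aQ * bP ≤ 2 * (c - a * b)
  -- Harris ingredients
  have hfm : Monotone f := fun a b hab => hF (openEdgeCluster_mono hab x)
  have hgm : Monotone g := fun a b hab => hG (openEdgeCluster_mono hab x)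
  have hf0 : ∀ a, 0 ≤ f a := fun a => hF0 _
  have hg0 : ∀ a, 0 ≤ g a := fun a => hG0 _
  have hup : ∀ (v : V) {a b : Set (Sym2 V)}, a ⊆ b → a ∈ {ω : Set (Sym2 V) | (openGraph ω).Reachable x v} →
      b ∈ {ω : Set (Sym2 V) | (openGraph ω).Reachable x v} := fun v a b hab ha => by
    simp only [Set.mem_setOf_eq] at ha ⊢
    exact ha.mono (openGraph_le hab)
  have hImono : ∀ (S : Set (Set (Sym2 V))), (∀ {a b : Set (Sym2 V)}, a ⊆ b → a ∈ S → b ∈ S) → Monotone (ind S) := by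
    intro S hS a b hab
    by_cases ha : a ∈ S
    · rw [ind_of_mem ha, ind_of_mem (hS hab ha)]
    · rw [ind_of_not_mem ha]; exact ind_nonneg S b
  have hIPm : Monotone (ind P) := hImono P (fun hab ha => hup p hab ha)
  have hIQm : Monotone (ind Q) := hImono Q (fun hab ha => hup q hab ha)
  have h1 : a * b ≤ c := by
    have := harris hw0 hw1 hf0 hg0 hfm hgm
    rw [hm, one_mul] at this
    exact this
  have h2a : a * πp ≤ aP := by
    have := harris hw0 hw1 hf0 (fun a => ind_nonneg P a) hfm hIPm
    rw [hm, one_mul] at this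
    exact this
  have h2b : b * πp ≤ bP := by
    have := harris hw0 hw1 hg0 (fun a => ind_nonneg P a) hgm hIPm
    rw [hm, one_mul] at this
    exact this
  have h2c : a * πq ≤ aQ := by
    have := harris hw0 hw1 hf0 (fun a => ind_nonneg Q a) hfm hIQm
    rw [hm, one_mul] at this
    exact this
  have h2d : b * πq ≤ bQ := by
    have := harris hw0 hw1 hg0 (fun a => ind_nonneg Q a) hgm hIQm
    rw [hm, one_mul] at this
    exact this
  have hπp0 : 0 ≤ πp := Finset.sum_nonneg fun ω _ => mul_nonneg (weight_nonneg hw0 hw1 ω) (ind_nonneg P ω)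
  have hπq0 : 0 ≤ πq := Finset.sum_nonneg fun ω _ => mul_nonneg (weight_nonneg hw0 hw1 ω) (ind_nonneg Q ω)
  have hπp1 : πp ≤ 1 := by
    have : πp ≤ ∑ ω, weight w ω :=
      Finset.sum_le_sum fun ω _ => by
        have := mul_le_mul_of_nonneg_left (ind_le_one P ω) (weight_nonneg hw0 hw1 ω)
        simpa using this
    rw [hm] at this; exact this
  have hπq1 : πq ≤ 1 := by
    have : πq ≤ ∑ ω, weight w ω :=
      Finset.sum_le_sum fun ω _ => by
        have := mul_le_mul_of_nonneg_left (ind_le_one Q ω) (weight_nonneg hw0 hw1 ω)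
        simpa using this
    rw [hm] at this; exact this
  -- the five-term identity
  have hT : 2 * (c - a * b) - (πq * cP + πp * cQ - aP * bQ - aQ * bP) =
      πq * ((c - cP) + (1 - πp) * c - (a - aP) * b - (b - bP) * a) +
        πp * ((c - cQ) + (1 - πq) * c - (a - aQ) * b - (b - bQ) * a) +
        2 * (1 - πp) * (1 - πq) * (c - a * b) + (aP - πp * a) * (bQ - πq * b) + (aQ - πq * a) * (bP - πp * b) := by
    ring
  have t1 : 0 ≤ πq * ((c - cP) + (1 - πp) * c - (a - aP) * b - (b - bP) * a) := mul_nonneg hπq0 hOp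
  have t2 : 0 ≤ πp * ((c - cQ) + (1 - πq) * c - (a - aQ) * b - (b - bQ) * a) := mul_nonneg hπp0 hOq
  have t3 : 0 ≤ 2 * (1 - πp) * (1 - πq) * (c - a * b) :=
    mul_nonneg (mul_nonneg (mul_nonneg (by norm_num) (by linarith)) (by linarith)) (by linarith)
  have t4 : 0 ≤ (aP - πp * a) * (bQ - πq * b) := mul_nonneg (by linarith) (by linarith)
  have t5 : 0 ≤ (aQ - πq * a) * (bP - πp * b) := mul_nonneg (by linarith) (by linarith)
  linarith

end Coefficientwise

end Summit.CriticalPhenomena.PercolationContinuityZ3.Theorems
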